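import Literature.Analysis.FunctionSpaces.TorusFourierSynthesis
import Literature.Analysis.FunctionSpaces.TorusFourierSeries

/-!
# Square-summability with all polynomial weights implies rapid decay on the lattice `ℤ^d`
(instab3 g4 — implementation 1 of the skew-cut X0 certifier, cell `ns-blowup`, 2026-08-26)

HONEST FRAMING (human ruling D-0035): nothing here is a claim about Navier–Stokes blow-up.
WHAT THIS IS NOT: not NS evidence; generic lattice bookkeeping for the X0 chain (KERNEL-CHAIN.md,
HOME/instab4). The abstract end of the chain (`SkewCutGalerkinMaster.exists_smooth_eigenvector_Ioo`,
`SkewCutGalerkinFromSections…`) delivers an eigenvector whose coordinates are square-summable against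
EVERY polynomial weight, `∑ w^{2s} |v_i|² < ∞ ∀ s` (`w² ≍ 1 + |k|²`); the synthesis door
(`SteadyLattice.isLinNSEigenvalue_of_fourier_eigen`, `AbcLinearisedLattice.isLinNSEigenvalue_abcFlow_of_*`)
wants `RapidDecay c`, i.e. `∑ (1 + |k|²)^m ‖c k‖ < ∞ ∀ m` (an `ℓ¹` condition). This file is the bridge:

* `rapidDecay_of_summable_sq_weights` — if `∑_k (1 + |k|²)^s ‖c k‖² < ∞` for every `s : ℕ`, then
  `RapidDecay c` (`2ab ≤ a² + b²` with `a = (1+|k|²)^{m+d} ‖c k‖`, `b = ((1+|k|²)^d)⁻¹`, and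
  `∑ ((1 + |k|²)^d)⁻¹ < ∞`, the tree's `Torus.summable_inv_one_add_freqNormSq_pow_card`).

Mathlib + the torus Fourier files; no definitions.
-/

noncomputable section

open scoped BigOperators Topology

namespace Summit.NavierStokesRegularity.FluidComputer.LatticeSqWeightsRapidDecay

open Literature.Analysis.FunctionSpaces Literature.Analysis.FunctionSpaces.Torus

variable {d : Type*} [Fintype d] {V : Type*} [NormedAddCommGroup V]

/-- **All-weights square-summability implies rapid decay.** For a family `c : ℤ^d → V`: if
`∑_k (1 + |k|²)^s ‖c k‖² < ∞` for every natural `s`, then `∑_k (1 + |k|²)^m ‖c k‖ < ∞` for every `m`,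
i.e. `RapidDecay c`. -/
theorem rapidDecay_of_summable_sq_weights {c : (d → ℤ) → V}
    (h : ∀ s : ℕ, Summable fun k : d → ℤ => (1 + freqNormSq k) ^ s * ‖c k‖ ^ 2) : RapidDecay c := by
  intro m
  set N := Fintype.card d with hN
  -- the majorant `(a² + b²) / 2`
  have hmaj : Summable fun k : d → ℤ =>
      ((1 + freqNormSq k) ^ (2 * (m + N)) * ‖c k‖ ^ 2 + ((1 + freqNormSq k) ^ N)⁻¹) / 2 :=
    ((h (2 * (m + N))).add summable_inv_one_add_freqNormSq_pow_card).div_const 2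
  refine Summable.of_nonneg_of_le (fun k => ?_) (fun k => ?_) hmaj
  · exact mul_nonneg (pow_nonneg (by linarith [freqNormSq_nonneg k]) _) (norm_nonneg _)
  · have hw : 1 ≤ 1 + freqNormSq k := by linarith [freqNormSq_nonneg k]
    have hw0 : 0 < 1 + freqNormSq k := by linarith
    set w := 1 + freqNormSq k with hwdef
    set a := w ^ (m + N) * ‖c k‖ with ha
    set b := (w ^ N)⁻¹ with hb
    have hab : a * b = w ^ m * ‖c k‖ := by
      rw [ha, hb, pow_add]
      field_simp
    have hb1 : b ^ 2 ≤ b := by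
      have hb0 : 0 ≤ b := by rw [hb]; positivity
      have hb1' : b ≤ 1 := by
        rw [hb]
        exact inv_le_one_of_one_le₀ (one_le_pow₀ hw)
      nlinarith
    have h2 : 2 * a * b ≤ a ^ 2 + b ^ 2 := two_mul_le_add_sq a b
    have ha2 : a ^ 2 = w ^ (2 * (m + N)) * ‖c k‖ ^ 2 := by
      rw [ha, mul_pow, ← pow_mul, mul_comm (m + N) 2]
    rw [mul_assoc, hab] at h2
    rw [← ha2]
    linarith

end Summit.NavierStokesRegularity.FluidComputer.LatticeSqWeightsRapidDecay

end
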